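import Literature.MathematicalPhysics.QuantumFieldTheory.Balaban1983to89.B15Prop1MinimiserFamilyGaugeCovariance
import Literature.MathematicalPhysics.QuantumFieldTheory.Balaban1983to89.B15Eq177ValueInvarianceB
import Literature.MathematicalPhysics.QuantumFieldTheory.Balaban1983to89.B15DeterminingSetsB

/-!
# `Balaban1983to89.B15Prop1MinimiserFamilyGaugeCovariance` — [Balaban1989LargeFieldI] = «[IV]», p. 194, the sentence after (1.77): *«The function is invariant with respect to — **BOND-DATUM EDITION** (`…B15Prop1MinimiserFamilyGaugeCovarianceB`, USED DECLARATIONS ONLY): the print-datum ([Balaban1984PropagatorsII] (2.3)) twins of the declarations of `B15Prop1MinimiserFamilyGaugeCovariance` that N12's junction of record v14ᴸ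
uses with a datum-bearing statement (`hMinBody_gaugeAct`, `hMinBody_gaugeAct_atRecord`, `hMinBody_of_gaugeAct_normalised`) — class (γ) of dag-n12-c's census-by-declaration v2 (bus [DAGN12C-G35], 2026-08-30).  GENERATOR (block-extracted from the
parent's tree bytes by HOME `lean/g35/gen/gen_blocks.py`): namespace `…B`, SAME names, `DetSet ↦ BDetSet` (F0a), `AgreeOn ↦ AgreeOnB`, `IsMinimizer ↦ IsMinimizerB`, `bondsOf (𝐁 j) ↦ 𝔅 j`, `constrCard ∕
constrEnum ∕ ConstrSet ∕ msChart ↦ …B` (lane `Node00/MultiScaleFibreChartB`), `IsCritOnFibre ∕ IsFibreChartNear ↦ …B`; proofs VERBATIM; the parent's other (datum-free) declarations REUSED by `open`.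

statement-level skeleton of published theorems with citation tags; proofs where landed; nothing here is a claim about
the Yang–Mills mass gap

Cell `pub-ymgap` (HUMAN RULINGS D-0062 ∕ D-0149), lane `pub-ymgap-dag-n12-c` g35 (R134 seat (a), N12 = [B15], s1, lane owner); `--kind proof --supports` K1⁹ `stmt-QuantumFields-27364`; count-neutral.
THEOREMS ONLY (0 `def`, 0 `instance`, 0 `sorry`).  HONESTY GUARD (director-ym №338 (5)): PURELY ADDITIVE — the parent stays landed and true on its own text; nothing in it is edited; no displayed
premise of any consumer is deleted or weakened; every hypothesis stays a hypothesis.  Nothing of Bałaban's analysis asserted; N12 NOT discharged; K0⁷ ∕ K1⁹ NOT closed; one finite 𝕋⁴ programme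
at fixed ε — nothing continuum ∕ ℝ⁴ ∕ OS; the Yang–Mills mass gap (Clay) is NOT proved by any of this.

PARENT's DOCSTRING (mathematics and citations; read `𝐁` as the bond datum `𝔅`):
# `Balaban1983to89.B15Prop1MinimiserFamilyGaugeCovariance` — [Balaban1989LargeFieldI] = «[IV]», p. 194, the sentence after (1.77): *«The function is invariant with respect to
# the group of all gauge transformations defined on Λ, hence it is natural to consider it on orbits of this group»*; [Balaban1989LargeFieldII] = «[LF-II]», p. 357 («the compensating
# adjoint gauge transformation on the variables B′»), p. 358 («holds for U₀ in an arbitrary gauge»); [Balaban1985Variational] = «[15]», (181) p. 307 («U_k(V^v) = U_k(V)^{v̄}»);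
# [Balaban1985BackgroundPropagators] (3.29) p. 395 («R(u) exp iηA = exp iηR(u)A R(u)»):
# ★★★ THE (J0′) CONCLUSION — THE HOLOMORPHIC BOUNDED FAMILY OF (2.12) MINIMISERS AROUND A BASE FIELD — IS GAUGE COVARIANT IN THE BASE FIELD

Honest framing: statement-level skeleton of published theorems with citation tags; proofs where landed; nothing here is a claim about the Yang–Mills mass gap.  Cell `pub-ymgap`
(HUMAN RULINGS D-0062 ∕ D-0149), lane `pub-ymgap-dag-n12-c` g27 (R134 seat (a), N12 = [B15], s1); count-neutral helper of K1⁹ `stmt-QuantumFields-27364` (`--kind proof --supports`);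
N12 NOT discharged; one finite 𝕋⁴ programme at fixed ε; nothing continuum ∕ ℝ⁴ ∕ OS ∕ mass-gap ∕ Clay.  THEOREMS ONLY (0 `def`, 0 `instance`, 0 `sorry`).

WHY (the lane's LOCATED-GAUGE-ORBIT, cell bus 2026-08-29, a located point on the lane's own «(J0′) OF RECORD» road).  The (J0′) letter of N12's knit reads, per instance and base
field `V_k` of the STRICT GUARD `PlaqSmallOn (plaqsInside (pts k (Z ∩ Λᶜ))) eR V_k` — a GAUGE-INVARIANT set of base fields —: «there is a family `Ũ(z)`, `z = (p, B′) ∈ (𝔤ᶜ)^{bonds}²`,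
holomorphic on `‖z‖ < R`, entrywise bounded by `𝓐₀`, whose real points are (2.12) minimisers for the data `M˙(Q_k^{s*}(e^{B′}·ext(e^{p}·V_k)))`» (the text below, `hMin`-body).  The
producers of record (`Summits/…/BalabanUVNodesN12MinimiserFamilyOfClass{ThresholdUniform, DatumLettersUniform}`) deliver it from per-base-field rows — the gauge row (δ) on the minimiser,
resp. the datum letter `∀ c ∈ 𝒞, dist1 ((ext V_k) c) ≤ ρn` — which are NOT gauge invariant: on the level-`0`-pinned bonds they read the datum's own bond variables, so at the pure gauge
`V_k′ := 1^g`, `g(y₁) = −1` at one `k`-site under `∂Ω₁(Z)`, they fail (`dist1 = 2`) although `V_k′` lies in every guard.  Asked for EVERY base field of the guard (the knit-side junctions'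
`hbase`), those rows are unsatisfiable.  PRINT's remedy is the sentence of p. 194: normalise the datum on its gauge orbit first.  THIS FILE supplies the kernel fact that makes the remedy
available to the (J0′) road: the `hMin`-body is COVARIANT along the orbit — if it holds at `W` with `(R, 𝓐)` it holds at `W^u` with `(R∕3, 4𝓐)` for every gauge transformation `u` of
`T^{(k)}` commuting with the extension (`ext (X^u) = (ext X)^u`; for print's p. 193 extension this is dag-n12-w6's `B15Prop1DatumGaugeNormalisation.extend_gaugeAct_of_eq_one`: `u = 1` on
`Λ^{(k)}` and at the corner).  So the rows need only be fed on a NORMALISED slice of the guard (w6's normalising gauge (A) `exists_gauge_normalising_extend` carries every base field into it),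
and the conclusion returns along the orbit; `R`, `𝓐₀` are per-instance binders of the knit, so nothing upstream changes.

MECHANISM ([LF-II] p. 357; [B-Prop] (3.29); [15] (181)).  `e^{p}·W^u = (e^{p̃}·W)^u` with the compensating rotation `p̃_b = Ad_{u(b₋)⁻¹} p_b` (w6's
`expMul_gaugeAct_eq_gaugeAct_expMul_ad`), twice; `Q_k^{s*}(Y^u) = (Q_k^{s*}Y)^{ū}` with the block lift `ū` (r11's `B15Eq177GaugeInvariance.qsstarGIter0_gaugeAct`); `M^j(U^{ū}) = (M^j U)^{ū↾}`
(r13's `iter_gaugeAct`); minimisers of `ū`-related data correspond under `U ↦ U^{ū}` (r11's `B15Eq177ValueInvariance.isMinimizer_gaugeAct_of_related`, class gauge invariant).  The family is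
transported by `Ũ′(z)(b) := ū(b₋)·Ũ(ρz)(b)·ū(b₊)⁻¹` with `ρ` the bondwise COMPLEXIFIED adjoint rotation (§1: a `ℂ`-linear map of `ℂ³` agreeing with `Ad` on real vectors, norm `≤ 3` in the
crude bound), so `ρ` maps the ball of radius `R∕3` into the ball of radius `R` (holomorphy by composition) and unitary conjugation costs a factor `4` on matrix entries (§2).

CONTENTS.  §1 `exists_adSU2C` · §2 `norm_conj_entry_le` · §3 ★★★ `hMinBody_gaugeAct` (generic lattice, averaging family, gauge-invariant class, determining set in the standing range,
extension commuting with `u`) · §4 ★★★ `hMinBody_gaugeAct_atRecord` (NODE 00's `avOfRecord F 2 Kt`, `regMSCoPOfRecord F 2 ν Kt k (maxDomT ν.M₁ Z)`, `Bj ν.M₁ Z k`, print's extension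
`extend (castSite '' [lo, hi]) (shellGauge · lo hi)`, `u = 1` on the box and at its corner), `gaugeAct_invG_gaugeAct`, ★★★ `hMinBody_of_gaugeAct_normalised` (RETURN ALONG THE ORBIT: the body at
the normalised representative `V^{ũ}` gives the body at `V`) · §5 `gaugeAct_one_apply`, `plaqSmallOn_gaugeAct_one`, ★ `dist1_le_of_forall_pureGauge_datumLetter` (the kernel certificate of the
witness: a datum letter on a bond the extension does not touch, asked of every pure gauge — all of which lie in every plaquette guard —, forces its tolerance above `dist1 h` for EVERY `h`).
HONEST SCOPE: group bookkeeping + finite-dimensional calculus over landed theorems; nothing of Bałaban's estimates asserted; count-neutral; N12 NOT discharged; K1⁹ NOT closed; R4 closes only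
the conditional finite-𝕋⁴ rung `BalabanLadder.UV` — no summit statement is proved here and NOT the Yang–Mills mass gap (Clay); nothing continuum ∕ ℝ⁴ ∕ OS.
-/


noncomputable section

open Set Metric
open scoped Matrix.Norms.L2Operator InnerProductSpace

namespace Literature.MathematicalPhysics.QuantumFieldTheory.Balaban1983to89.B15Prop1MinimiserFamilyGaugeCovarianceB

open B15Prop1MinimiserFamilyGaugeCovariance


open B15DeterminingSetsB

open GaugeField B15DeterminingSets B16Sect1Backgrounds T4Continuum
open B15Prop1ChartSU2 (su2Chart adSU2)
open B15Prop1ChartCalculusSU2 (E3)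
open B15Prop1DatumGaugeNormalisation (norm_adSU2_eq expMul_gaugeAct_eq_gaugeAct_expMul_ad extend_gaugeAct_of_eq_one)
open B15Prop1AnalyticExtClause (cplxVec)
open B15Eq177GaugeInvariance (blockLift qsstarGIter0_gaugeAct)
open B15Eq177ValueInvariance (isMinimizerB_gaugeAct_of_related)
open Literature.MathematicalPhysics.QuantumFieldTheory.BalabanImbrieJaffe1984to88.BIJ85Eq453GaugeField (qsstarGIter0)
open T4CubeChartGnomonic (SU2)



section
variable {P : Params} {k : ℕ}

/-- ★★★ **THE (J0′) CONCLUSION IS GAUGE COVARIANT IN THE BASE FIELD** (generic lattice `P`, averaging family `av`, a GAUGE-INVARIANT class `reg`, a determining set `𝔅` void above the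
standing range, a level `k ≤ m + K`, an extension `ext` COMMUTING with the gauge transformation `u` of `T^{(k)}`).  If the `hMin`-body holds at the base field `W` with radius `R` and
entry bound `𝓐` — a family `Ũ(z)` holomorphic on `‖z‖ < R`, `|Ũ(z)_b,ij| ≤ 𝓐`, whose real points `(p, B′)` are (2.12) minimisers for the data `M˙(Q_k^{s*}(e^{B′}·ext(e^{p}·W)))` — then it
holds at `W^u` with radius `R∕3` and bound `4𝓐`: the transported family is `z ↦ ū(b₋)·Ũ(ρz)(b)·ū(b₊)⁻¹`, `ρ` the bondwise complexified rotation `Ad_{u(b₋)⁻¹}` (§1), `ū = blockLift k u`.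
[cite: Balaban1989LargeFieldI, p.194 (sentence after (1.77)); Balaban1989LargeFieldII, p.357, p.358; Balaban1985Variational, (181) p.307; Balaban1985BackgroundPropagators, (3.29) p.395; Balaban1988Convergent, (2.12) p.256] -/
theorem hMinBody_gaugeAct (av : ∀ j, Averaging P j SU2) {reg : Set (GaugeField P 0 SU2)}
    (hreg : ∀ (w : GaugeTransf P 0 SU2) (U : GaugeField P 0 SU2), U ∈ reg → gaugeAct w U ∈ reg)
    {𝔅 : BDetSet P} (h𝔅 : ∀ j, P.m + P.K < j → 𝔅 j = ∅) (hk : k ≤ P.m + P.K)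
    (ext : GaugeField P k SU2 → GaugeField P k SU2) (u : GaugeTransf P k SU2) (hext : ∀ X : GaugeField P k SU2, ext (gaugeAct u X) = gaugeAct u (ext X))
    (W : GaugeField P k SU2) {R 𝓐 : ℝ}
    (h : ∃ Ũ : VecField P k (EuclideanSpace ℂ (Fin 3)) × VecField P k (EuclideanSpace ℂ (Fin 3)) → PBond P 0 → Matrix (Fin 2) (Fin 2) ℂ,
      (∀ b i j, DifferentiableOn ℂ (fun z => Ũ z b i j) (ball 0 R)) ∧
      (∀ z ∈ ball (0 : VecField P k (EuclideanSpace ℂ (Fin 3)) × VecField P k (EuclideanSpace ℂ (Fin 3))) R, ∀ b i j, ‖Ũ z b i j‖ ≤ 𝓐) ∧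
      ∀ p B' : VecField P k E3, ‖p‖ < R → ‖B'‖ < R → ∃ U' : GaugeField P 0 SU2,
        (∀ b, Ũ (cplxVec p, cplxVec B') b = ((U' b : SU2) : Matrix (Fin 2) (Fin 2) ℂ)) ∧
          IsMinimizerB av reg 𝔅 (avgFamily av (qsstarGIter0 k (expMul su2Chart B' (ext (expMul su2Chart p W))))) U') :
    ∃ Ũ : VecField P k (EuclideanSpace ℂ (Fin 3)) × VecField P k (EuclideanSpace ℂ (Fin 3)) → PBond P 0 → Matrix (Fin 2) (Fin 2) ℂ,
      (∀ b i j, DifferentiableOn ℂ (fun z => Ũ z b i j) (ball 0 (R / 3))) ∧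
      (∀ z ∈ ball (0 : VecField P k (EuclideanSpace ℂ (Fin 3)) × VecField P k (EuclideanSpace ℂ (Fin 3))) (R / 3), ∀ b i j, ‖Ũ z b i j‖ ≤ 4 * 𝓐) ∧
      ∀ p B' : VecField P k E3, ‖p‖ < R / 3 → ‖B'‖ < R / 3 → ∃ U' : GaugeField P 0 SU2,
        (∀ b, Ũ (cplxVec p, cplxVec B') b = ((U' b : SU2) : Matrix (Fin 2) (Fin 2) ℂ)) ∧
          IsMinimizerB av reg 𝔅 (avgFamily av (qsstarGIter0 k (expMul su2Chart B' (ext (expMul su2Chart p (gaugeAct u W)))))) U' := by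
  classical
  obtain ⟨Ũ, hhol, hbd, hreal⟩ := h
  -- §1 bondwise: the complexified rotations `Ad_{u(b₋)⁻¹}`
  choose L hLre hLnorm using fun b : PBond P k => exists_adSU2C (u b.src)⁻¹
  -- the parameter map `ρ`
  let Φ : VecField P k (EuclideanSpace ℂ (Fin 3)) →L[ℂ] VecField P k (EuclideanSpace ℂ (Fin 3)) :=
    ContinuousLinearMap.pi fun b => (L b).comp (ContinuousLinearMap.proj b)
  let ρ : (VecField P k (EuclideanSpace ℂ (Fin 3)) × VecField P k (EuclideanSpace ℂ (Fin 3))) →L[ℂ]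
      (VecField P k (EuclideanSpace ℂ (Fin 3)) × VecField P k (EuclideanSpace ℂ (Fin 3))) :=
    (Φ.comp (ContinuousLinearMap.fst ℂ _ _)).prod (Φ.comp (ContinuousLinearMap.snd ℂ _ _))
  have hΦ : ∀ x b, Φ x b = L b (x b) := fun x b => rfl
  have hΦn : ∀ x, ‖Φ x‖ ≤ 3 * ‖x‖ := fun x =>
    (pi_norm_le_iff_of_nonneg (by positivity)).2 fun b =>
      (hΦ x b ▸ hLnorm b (x b)).trans (mul_le_mul_of_nonneg_left (norm_le_pi_norm x b) (by norm_num))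
  have hρ : ∀ z, ρ z = (Φ z.1, Φ z.2) := fun z => rfl
  have hρn : ∀ z, ‖ρ z‖ ≤ 3 * ‖z‖ := fun z => by
    rw [hρ, Prod.norm_def]
    exact max_le ((hΦn z.1).trans (mul_le_mul_of_nonneg_left (norm_fst_le z) (by norm_num)))
      ((hΦn z.2).trans (mul_le_mul_of_nonneg_left (norm_snd_le z) (by norm_num)))
  have hmaps : MapsTo ρ (ball 0 (R / 3)) (ball 0 R) := fun z hz => by
    rw [mem_ball_zero_iff] at hz ⊢
    have := hρn z
    linarith
  -- on real parameters `ρ` is the compensated rotation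
  have hρre : ∀ p B' : VecField P k E3,
      ρ (cplxVec p, cplxVec B') = (cplxVec (fun b => adSU2 (u b.src)⁻¹ (p b)), cplxVec (fun b => adSU2 (u b.src)⁻¹ (B' b))) := by
    intro p B'
    rw [hρ]
    refine Prod.ext (funext fun b => ?_) (funext fun b => ?_)
    · exact hLre b (p b)
    · exact hLre b (B' b)
  -- the lifted fine gauge and the transported family
  refine ⟨fun z b => ((blockLift k u b.src : SU2) : Matrix (Fin 2) (Fin 2) ℂ) * Ũ (ρ z) b * (((blockLift k u b.tgt)⁻¹ : SU2) : Matrix (Fin 2) (Fin 2) ℂ),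
    fun b i j => ?_, fun z hz b i j => ?_, fun p B' hp hB' => ?_⟩
  · -- holomorphy: entries are finite sums of constants times entries of `Ũ ∘ ρ`
    have hcomp : ∀ k' l, DifferentiableOn ℂ (fun z => Ũ (ρ z) b k' l) (ball 0 (R / 3)) := fun k' l =>
      (hhol b k' l).comp ρ.differentiable.differentiableOn hmaps
    have hfun : (fun z => (((blockLift k u b.src : SU2) : Matrix (Fin 2) (Fin 2) ℂ) * Ũ (ρ z) b *
          (((blockLift k u b.tgt)⁻¹ : SU2) : Matrix (Fin 2) (Fin 2) ℂ)) i j) =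
        fun z => ∑ l, (∑ k', ((blockLift k u b.src : SU2) : Matrix (Fin 2) (Fin 2) ℂ) i k' * Ũ (ρ z) b k' l) *
          (((blockLift k u b.tgt)⁻¹ : SU2) : Matrix (Fin 2) (Fin 2) ℂ) l j := by
      funext z; simp only [Matrix.mul_apply]
    rw [hfun]
    exact DifferentiableOn.fun_sum fun l _ => (DifferentiableOn.fun_sum fun k' _ => (hcomp k' l).const_mul _).mul_const _
  · -- the entry bound
    exact norm_conj_entry_le (Matrix.mem_specialUnitaryGroup_iff.1 (blockLift k u b.src).2).1
      (Matrix.mem_specialUnitaryGroup_iff.1 ((blockLift k u b.tgt)⁻¹).2).1 (fun i' j' => hbd (ρ z) (hmaps hz) b i' j') i j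
  · -- real points: the compensated parameters, the minimiser of the rotated data, its transport by `ū`
    have hR3 : R / 3 ≤ R := by
      have : 0 < R := by
        have h0 := norm_nonneg p
        linarith
      linarith
    obtain ⟨U', hU'eq, hU'min⟩ := hreal (fun b => adSU2 (u b.src)⁻¹ (p b)) (fun b => adSU2 (u b.src)⁻¹ (B' b))
      ((norm_ad_le u p).trans_lt (hp.trans_le hR3)) ((norm_ad_le u B').trans_lt (hB'.trans_le hR3))
    refine ⟨gaugeAct (blockLift k u) U', fun b => ?_, ?_⟩
    · show ((blockLift k u b.src : SU2) : Matrix (Fin 2) (Fin 2) ℂ) * Ũ (ρ (cplxVec p, cplxVec B')) b *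
          (((blockLift k u b.tgt)⁻¹ : SU2) : Matrix (Fin 2) (Fin 2) ℂ) = ((gaugeAct (blockLift k u) U' b : SU2) : Matrix (Fin 2) (Fin 2) ℂ)
      rw [hρre, hU'eq b]
      simp only [gaugeAct, Submonoid.coe_mul]
    · have hY : expMul su2Chart B' (ext (expMul su2Chart p (gaugeAct u W))) =
          gaugeAct u (expMul su2Chart (fun b => adSU2 (u b.src)⁻¹ (B' b)) (ext (expMul su2Chart (fun b => adSU2 (u b.src)⁻¹ (p b)) W))) := by
        rw [expMul_gaugeAct_eq_gaugeAct_expMul_ad u p W, hext, expMul_gaugeAct_eq_gaugeAct_expMul_ad u B']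
      rw [hY, qsstarGIter0_gaugeAct k hk u]
      exact isMinimizerB_gaugeAct_of_related av hreg h𝔅 (blockLift k u)
        (V := avgFamily av (qsstarGIter0 k (expMul su2Chart (fun b => adSU2 (u b.src)⁻¹ (B' b))
          (ext (expMul su2Chart (fun b => adSU2 (u b.src)⁻¹ (p b)) W)))))
        (fun j hj => iter_gaugeAct av (blockLift k u) _ j hj) hU'min

end

section
open B14.Eq213DetSet (Bj maxDomT Bj_of_gt)
open T4AxialGaugeSmallField (castSite)
open B15Extension193 (extend)
open B15ShellGauge193 (shellGauge)
open B15Eq177ValueInvarianceCoDiv (gaugeAct_mem_regMSCoPOfRecord)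

/-- ★★★ **THE (J0′) CONCLUSION OF RECORD IS GAUGE COVARIANT IN THE BASE FIELD** — §3 at NODE 00's averaging `M˙`, the (2.12) class of record `U_k({Ω_j(Z)}, εreg)` (gauge invariant:
`B15Eq177ValueInvarianceCoDiv.gaugeAct_mem_regMSCoPOfRecord`), the determining set `𝐁_k(Z)` (void above level `k ≤ m + K`), and print's p. 193 extension
`ext V = extend (castSite '' [lo, hi]) (shellGauge V lo hi) V` — for EVERY gauge transformation `u` of `T^{(k)}` equal to `1` on the box `castSite '' [lo, hi]` and at its corner
`castSite (lo − 1)` (dag-n12-w6's `extend_gaugeAct_of_eq_one`: the extension commutes with such `u`): the `hMin`-body at `W` with `(R, 𝓐)` gives the `hMin`-body at `W^u` with `(R∕3, 4𝓐)` —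
the text of U2 ∕ U3's conclusion and of the knit's `hMin` row, VERBATIM in shape.  USE: feed the producers' per-base-field rows on a NORMALISED representative `W := V_k^{u⁻¹}` (w6's
`exists_gauge_normalising_extend`) and return to `V_k` along the orbit. [cite: Balaban1989LargeFieldI, p.193, p.194 (sentence after (1.77)); Balaban1989LargeFieldII, p.357, p.358, (1.12)–(1.13) p.359; Balaban1985Variational, (2) p.278, (181) p.307; Balaban1988Convergent, (2.12)–(2.13) pp.256–257] -/
theorem hMinBody_gaugeAct_atRecord {F : T4Family} (ν : Node00.Stage7Numerics) (Kt : ℕ) {k : ℕ} (hk : k ≤ (F.P Kt).m + (F.P Kt).K)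
    (bd : ℕ → (ℕ → Set (Site (F.P Kt) 0)) → BDetSet (F.P Kt)) (Z : Set (Site (F.P Kt) 0))
    (hbd : ∀ j, (F.P Kt).m + (F.P Kt).K < j → bd k (maxDomT ν.M₁ Z) j = ∅) {lo hi : Fin (F.P Kt).d → ℤ} (hN : ∀ κ, hi κ - lo κ + 3 < ((F.P Kt).sitesPerDir k : ℤ))
    (ext : GaugeField (F.P Kt) k SU2 → GaugeField (F.P Kt) k SU2)
    (hext : ∀ V, ext V = extend (castSite '' Set.Icc lo hi : Set (Site (F.P Kt) k)) (shellGauge V lo hi) V)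
    (u : GaugeTransf (F.P Kt) k SU2) (hu : ∀ s ∈ (castSite '' Set.Icc lo hi : Set (Site (F.P Kt) k)), u s = 1) (hu₀ : u (castSite (lo - 1)) = 1)
    (W : GaugeField (F.P Kt) k SU2) {R 𝓐 : ℝ}
    (h : ∃ Ũ : VecField (F.P Kt) k (EuclideanSpace ℂ (Fin 3)) × VecField (F.P Kt) k (EuclideanSpace ℂ (Fin 3)) → PBond (F.P Kt) 0 → Matrix (Fin 2) (Fin 2) ℂ,
      (∀ b i j, DifferentiableOn ℂ (fun z => Ũ z b i j) (ball 0 R)) ∧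
      (∀ z ∈ ball (0 : VecField (F.P Kt) k (EuclideanSpace ℂ (Fin 3)) × VecField (F.P Kt) k (EuclideanSpace ℂ (Fin 3))) R, ∀ b i j, ‖Ũ z b i j‖ ≤ 𝓐) ∧
      ∀ p B' : VecField (F.P Kt) k E3, ‖p‖ < R → ‖B'‖ < R → ∃ U' : GaugeField (F.P Kt) 0 SU2,
        (∀ b, Ũ (cplxVec p, cplxVec B') b = ((U' b : SU2) : Matrix (Fin 2) (Fin 2) ℂ)) ∧
          IsMinimizerB (Node00.avOfRecord F 2 Kt) (Node00.regMSCoPOfRecord F 2 ν Kt k (maxDomT ν.M₁ Z)) (bd k (maxDomT ν.M₁ Z))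
            (avgFamily (Node00.avOfRecord F 2 Kt) (qsstarGIter0 k (expMul su2Chart B' (ext (expMul su2Chart p W))))) U') :
    ∃ Ũ : VecField (F.P Kt) k (EuclideanSpace ℂ (Fin 3)) × VecField (F.P Kt) k (EuclideanSpace ℂ (Fin 3)) → PBond (F.P Kt) 0 → Matrix (Fin 2) (Fin 2) ℂ,
      (∀ b i j, DifferentiableOn ℂ (fun z => Ũ z b i j) (ball 0 (R / 3))) ∧
      (∀ z ∈ ball (0 : VecField (F.P Kt) k (EuclideanSpace ℂ (Fin 3)) × VecField (F.P Kt) k (EuclideanSpace ℂ (Fin 3))) (R / 3), ∀ b i j, ‖Ũ z b i j‖ ≤ 4 * 𝓐) ∧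
      ∀ p B' : VecField (F.P Kt) k E3, ‖p‖ < R / 3 → ‖B'‖ < R / 3 → ∃ U' : GaugeField (F.P Kt) 0 SU2,
        (∀ b, Ũ (cplxVec p, cplxVec B') b = ((U' b : SU2) : Matrix (Fin 2) (Fin 2) ℂ)) ∧
          IsMinimizerB (Node00.avOfRecord F 2 Kt) (Node00.regMSCoPOfRecord F 2 ν Kt k (maxDomT ν.M₁ Z)) (bd k (maxDomT ν.M₁ Z))
            (avgFamily (Node00.avOfRecord F 2 Kt) (qsstarGIter0 k (expMul su2Chart B' (ext (expMul su2Chart p (gaugeAct u W)))))) U' :=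
  hMinBody_gaugeAct (Node00.avOfRecord F 2 Kt) (fun w U hU => gaugeAct_mem_regMSCoPOfRecord ν Kt k (maxDomT ν.M₁ Z) w U hU)
    hbd hk ext u
    (fun X => by rw [hext, hext, extend_gaugeAct_of_eq_one hN u X hu hu₀]) W h

end

section
open B14.Eq213DetSet (Bj maxDomT Bj_of_gt)
open T4AxialGaugeSmallField (castSite)
open B15Extension193 (extend)
open B15ShellGauge193 (shellGauge)
open B15Eq177ValueInvarianceCoDiv (gaugeAct_mem_regMSCoPOfRecord)

/-- ★★★ **RETURN ALONG THE ORBIT** — the form the knit-side composition uses: if `ũ` is `1` on the box and at its corner (dag-n12-w6's normalising gauge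
`exists_gauge_normalising_extend_shellGauged` has both) and the `hMin`-body holds at the NORMALISED representative `V^{ũ}` with `(R, 𝓐)`, then it holds at `V` itself with `(R∕3, 4𝓐)`
(§4 at `u := ũ⁻¹`, `W := V^{ũ}`). [cite: Balaban1989LargeFieldI, p.194 (sentence after (1.77)); Balaban1989LargeFieldII, p.357, p.358; Balaban1985Variational, (181) p.307] -/
theorem hMinBody_of_gaugeAct_normalised {F : T4Family} (ν : Node00.Stage7Numerics) (Kt : ℕ) {k : ℕ} (hk : k ≤ (F.P Kt).m + (F.P Kt).K)
    (bd : ℕ → (ℕ → Set (Site (F.P Kt) 0)) → BDetSet (F.P Kt)) (Z : Set (Site (F.P Kt) 0))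
    (hbd : ∀ j, (F.P Kt).m + (F.P Kt).K < j → bd k (maxDomT ν.M₁ Z) j = ∅) {lo hi : Fin (F.P Kt).d → ℤ} (hN : ∀ κ, hi κ - lo κ + 3 < ((F.P Kt).sitesPerDir k : ℤ))
    (ext : GaugeField (F.P Kt) k SU2 → GaugeField (F.P Kt) k SU2)
    (hext : ∀ V, ext V = extend (castSite '' Set.Icc lo hi : Set (Site (F.P Kt) k)) (shellGauge V lo hi) V)
    (ũ : GaugeTransf (F.P Kt) k SU2) (hu : ∀ s ∈ (castSite '' Set.Icc lo hi : Set (Site (F.P Kt) k)), ũ s = 1) (hu₀ : ũ (castSite (lo - 1)) = 1)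
    (V : GaugeField (F.P Kt) k SU2) {R 𝓐 : ℝ}
    (h : ∃ Ũ : VecField (F.P Kt) k (EuclideanSpace ℂ (Fin 3)) × VecField (F.P Kt) k (EuclideanSpace ℂ (Fin 3)) → PBond (F.P Kt) 0 → Matrix (Fin 2) (Fin 2) ℂ,
      (∀ b i j, DifferentiableOn ℂ (fun z => Ũ z b i j) (ball 0 R)) ∧
      (∀ z ∈ ball (0 : VecField (F.P Kt) k (EuclideanSpace ℂ (Fin 3)) × VecField (F.P Kt) k (EuclideanSpace ℂ (Fin 3))) R, ∀ b i j, ‖Ũ z b i j‖ ≤ 𝓐) ∧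
      ∀ p B' : VecField (F.P Kt) k E3, ‖p‖ < R → ‖B'‖ < R → ∃ U' : GaugeField (F.P Kt) 0 SU2,
        (∀ b, Ũ (cplxVec p, cplxVec B') b = ((U' b : SU2) : Matrix (Fin 2) (Fin 2) ℂ)) ∧
          IsMinimizerB (Node00.avOfRecord F 2 Kt) (Node00.regMSCoPOfRecord F 2 ν Kt k (maxDomT ν.M₁ Z)) (bd k (maxDomT ν.M₁ Z))
            (avgFamily (Node00.avOfRecord F 2 Kt) (qsstarGIter0 k (expMul su2Chart B' (ext (expMul su2Chart p (gaugeAct ũ V)))))) U') :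
    ∃ Ũ : VecField (F.P Kt) k (EuclideanSpace ℂ (Fin 3)) × VecField (F.P Kt) k (EuclideanSpace ℂ (Fin 3)) → PBond (F.P Kt) 0 → Matrix (Fin 2) (Fin 2) ℂ,
      (∀ b i j, DifferentiableOn ℂ (fun z => Ũ z b i j) (ball 0 (R / 3))) ∧
      (∀ z ∈ ball (0 : VecField (F.P Kt) k (EuclideanSpace ℂ (Fin 3)) × VecField (F.P Kt) k (EuclideanSpace ℂ (Fin 3))) (R / 3), ∀ b i j, ‖Ũ z b i j‖ ≤ 4 * 𝓐) ∧
      ∀ p B' : VecField (F.P Kt) k E3, ‖p‖ < R / 3 → ‖B'‖ < R / 3 → ∃ U' : GaugeField (F.P Kt) 0 SU2,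
        (∀ b, Ũ (cplxVec p, cplxVec B') b = ((U' b : SU2) : Matrix (Fin 2) (Fin 2) ℂ)) ∧
          IsMinimizerB (Node00.avOfRecord F 2 Kt) (Node00.regMSCoPOfRecord F 2 ν Kt k (maxDomT ν.M₁ Z)) (bd k (maxDomT ν.M₁ Z))
            (avgFamily (Node00.avOfRecord F 2 Kt) (qsstarGIter0 k (expMul su2Chart B' (ext (expMul su2Chart p V))))) U' := by
  have h' := hMinBody_gaugeAct_atRecord ν Kt hk bd Z hbd hN ext hext (invG ũ) (fun s hs => by simp [invG, hu s hs]) (by rw [invG, hu₀, inv_one]) (gaugeAct ũ V) h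
  rw [gaugeAct_invG_gaugeAct] at h'
  exact h'

end

end Literature.MathematicalPhysics.QuantumFieldTheory.Balaban1983to89.B15Prop1MinimiserFamilyGaugeCovarianceB

end
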